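import Literature.Barriers.AtomisticToContinuum.AnticontinuumLocalizationBounds2
import Literature.Barriers.AtomisticToContinuum.AnticontinuumLocalizationMajorant
import Literature.Barriers.AtomisticToContinuum.AnticontinuumLocalizationZMeasure
import HarnessLib

/-!
# De Roeck–Huveneers 2015, Theorem 1 for the rotor chain on a window, from resonance cut-offs

`Literature/Barriers/AtomisticToContinuum/` — the assembly of §5 of W. De Roeck, F. Huveneers,
CPAM 68 (2015), arXiv:1305.5127: given resonance cut-offs `Θ` (the interface to §4), a bond of
the window with ROOM, `n₁ = 2n₀ + 1` stages and the scale `δ = ε^{1/4}`, the explicit pair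
`U = U₀`, `G = G₀` of `AnticontinuumLocalizationSolution.lean` is a WINDOW SOLUTION in the sense of
`AnticontinuumLocalizationThm1Window.lean` — smooth, `2π`-periodic in the angles, local within
`locRad`, `εJ = L_H U + ε^{n₀+1} G`, and the four Gaussian bounds `⟨U²⟩ ≤ Cε^{1/4}`,
`⟨(∂U)²⟩ ≤ Cε^{-1/4}`, `⟨G²⟩ ≤ C`, `⟨(∂G)²⟩ ≤ C` for `0 < ε < 1` (`windowSolution_of_cutoffs`,
PROVED). The exponent bookkeeping: `n₂ ≥ 8n₀ + 12`. [cite: DeRoeckHuveneers2015, §2.3 Thm 1 and §5.6]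
-/

noncomputable section

open MeasureTheory ProbabilityTheory Function Set Finset Filter Metric
open scoped ENNReal NNReal ContDiff BigOperators Topology

namespace Literature.Barriers.AtomisticToContinuum.HeatConduction.RotorChain

open Literature.MathematicalPhysics.KineticTheory.HeatConduction
open Literature.Analysis.Calculus Literature.Analysis.Calculus.IsDeltaSymbol
open Literature.Algebra.Lie Literature.Algebra.Lie.TruncSeries
open Literature.Probability.Distributions

variable {m : ℕ}

/-! ### The scale `δ = ε^{1/4}` -/

/-- The scale. [cite: DeRoeckHuveneers2015, §5.6 ("Let us fix `δ = ε^{1/4}`")] -/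
def scale (ε : ℝ) : ℝ := ε ^ (1 / 4 : ℝ)

/-- `δ > 0`. [folklore] -/
theorem scale_pos {ε : ℝ} (hε : 0 < ε) : 0 < scale ε := Real.rpow_pos_of_pos hε _

/-- `δ ≤ 1` for `ε ≤ 1`. [folklore] -/
theorem scale_le_one {ε : ℝ} (hε : 0 < ε) (hε1 : ε ≤ 1) : scale ε ≤ 1 := Real.rpow_le_one hε.le hε1 (by norm_num)

/-- `ε^j δ^{-k} = ε^{j - k/4}`. [folklore] -/
theorem pow_div_scale_pow {ε : ℝ} (hε : 0 < ε) (j k : ℕ) : ε ^ j / scale ε ^ k = ε ^ ((j : ℝ) - (k : ℝ) / 4) := by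
  rw [scale, ← Real.rpow_natCast ε j, ← Real.rpow_natCast (ε ^ (1 / 4 : ℝ)) k, ← Real.rpow_mul hε.le, Real.rpow_sub hε]
  ring_nf

/-- `δ^{-k} = ε^{-k/4}`. [folklore] -/
theorem one_div_scale_pow {ε : ℝ} (hε : 0 < ε) (k : ℕ) : 1 / scale ε ^ k = ε ^ (-((k : ℝ) / 4)) := by
  have := pow_div_scale_pow hε 0 k
  rw [pow_zero] at this
  rw [this]; ring_nf

/-- **Scale sums**: `∑_{j ∈ s} ε^j δ^{-(2j+c)} ≤ |s| ε^e` when every exponent `j - (2j+c)/4 ≥ e` (`ε ≤ 1`). [folklore] -/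
theorem sum_scale_le {ε : ℝ} (hε : 0 < ε) (hε1 : ε ≤ 1) (s : Finset ℕ) (c : ℕ) (e : ℝ)
    (h : ∀ j ∈ s, e ≤ (j : ℝ) - ((2 * j + c : ℕ) : ℝ) / 4) :
    ∑ j ∈ s, ε ^ j / scale ε ^ (2 * j + c) ≤ s.card * ε ^ e := by
  calc ∑ j ∈ s, ε ^ j / scale ε ^ (2 * j + c) = ∑ j ∈ s, ε ^ ((j : ℝ) - ((2 * j + c : ℕ) : ℝ) / 4) :=
        Finset.sum_congr rfl fun j _ => pow_div_scale_pow hε j _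
    _ ≤ ∑ j ∈ s, ε ^ e := Finset.sum_le_sum fun j hj => Real.rpow_le_rpow_of_exponent_ge hε hε1 (h j hj)
    _ = s.card * ε ^ e := by rw [Finset.sum_const, nsmul_eq_mul]

/-! ### Smoothness and periodicity of `U₀`, `G₀` -/

section Regularity

variable {r L n₂ : ℕ} {Θ : ResonanceCutoffs m r L n₂} {b : Fin m} {n₃ : ℕ} {γ : ℝ} {n : ℕ}

/-- `U₀` is smooth. [cite: DeRoeckHuveneers2015, §2.3 Thm 1 ("The functions `U_a` and `G_a` are smooth")] -/
theorem contDiff_U0 (ε δ : ℝ) : ContDiff ℝ ∞ (U0 Θ b n₃ γ n ε δ) :=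
  (contDiff_tailEnergy m ε γ _).sub (SmoothFun.contDiff _)

/-- `A` is smooth. [folklore] -/
theorem contDiff_Aterm (ε δ : ℝ) : ContDiff ℝ ∞ (Aterm Θ b n₃ γ n ε δ) := SmoothFun.contDiff _

/-- `B` is smooth. [folklore] -/
theorem contDiff_Bterm (δ : ℝ) : ContDiff ℝ ∞ (Bterm Θ b n₃ γ n δ) :=
  contDiff_top_poisson (contDiff_potentialEnergy m γ) (SmoothFun.contDiff _)

/-- `G₀` is smooth. [cite: DeRoeckHuveneers2015, §2.3 Thm 1] -/
theorem contDiff_G0 (n₀ : ℕ) (ε δ : ℝ) : ContDiff ℝ ∞ (G0 Θ b n₃ γ n₀ n ε δ) :=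
  contDiff_const.mul ((contDiff_Aterm ε δ).add (contDiff_const.mul (contDiff_Bterm δ)))

/-- `U₀` in evaluated symbolic form. [folklore] -/
theorem U0_eq_ev_form {δ : ℝ} (hδ : 0 < δ) (hδ1 : δ ≤ 1) (ε : ℝ) (z : PhaseSpace m) :
    U0 Θ b n₃ γ n ε δ z = TrigPoly.ev (tailD b) δ z + ε * TrigPoly.ev (tailV b γ) δ z -
      ∑ j ∈ Finset.range (n + 1), ε ^ j * TrigPoly.ev (RhgtSym Θ b n₃ γ n j) δ z := by
  unfold U0; rw [eval_Rhgt_eq_sum hδ hδ1, tailEnergy_eq_ev ε γ δ z]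

/-- `U₀` is `2π`-periodic in every angle. [cite: DeRoeckHuveneers2015, §2.1 (`Ω = (𝕋 × ℝ)^N`)] -/
theorem isAnglePeriodic_U0 {δ : ℝ} (hδ : 0 < δ) (hδ1 : δ ≤ 1) (ε : ℝ) : IsAnglePeriodic m (U0 Θ b n₃ γ n ε δ) := by
  intro z x
  rw [U0_eq_ev_form hδ hδ1, U0_eq_ev_form hδ hδ1, TrigPoly.ev_update_add_two_pi, TrigPoly.ev_update_add_two_pi]
  congr 1
  exact Finset.sum_congr rfl fun j _ => by rw [TrigPoly.ev_update_add_two_pi]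

/-- `G₀` is `2π`-periodic in every angle. [cite: DeRoeckHuveneers2015, §2.1] -/
theorem isAnglePeriodic_G0 {δ : ℝ} (hδ : 0 < δ) (hδ1 : δ ≤ 1) (n₀ : ℕ) (ε : ℝ) : IsAnglePeriodic m (G0 Θ b n₃ γ n₀ n ε δ) := by
  intro z x
  unfold G0
  rw [Aterm_eq_sum hδ hδ1, Aterm_eq_sum hδ hδ1, Bterm_eq_ev hδ hδ1, Bterm_eq_ev hδ hδ1, TrigPoly.ev_update_add_two_pi]
  congr 2
  exact Finset.sum_congr rfl fun l _ => by rw [TrigPoly.ev_update_add_two_pi]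

/-- Derivatives of `G₀ = ε^{-(n₀+1)}(A + ε^{n+1}B)`. [folklore] -/
theorem partial_G0 (n₀ : ℕ) (ε δ : ℝ) (y : Fin m) (z : PhaseSpace m) :
    partialQ y (G0 Θ b n₃ γ n₀ n ε δ) z = (ε ^ (n₀ + 1))⁻¹ * (partialQ y (Aterm Θ b n₃ γ n ε δ) z + ε ^ (n + 1) * partialQ y (Bterm Θ b n₃ γ n δ) z) ∧
    partialP y (G0 Θ b n₃ γ n₀ n ε δ) z = (ε ^ (n₀ + 1))⁻¹ * (partialP y (Aterm Θ b n₃ γ n ε δ) z + ε ^ (n + 1) * partialP y (Bterm Θ b n₃ γ n δ) z) := by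
  have hA : Differentiable ℝ (Aterm Θ b n₃ γ n ε δ) := (contDiff_Aterm ε δ).differentiable (by simp)
  have hB : Differentiable ℝ (Bterm Θ b n₃ γ n δ) := (contDiff_Bterm δ).differentiable (by simp)
  have hB' : Differentiable ℝ (fun z => ε ^ (n + 1) * Bterm Θ b n₃ γ n δ z) := hB.const_mul _
  have e : G0 Θ b n₃ γ n₀ n ε δ = fun z => (ε ^ (n₀ + 1))⁻¹ * (Aterm Θ b n₃ γ n ε δ + fun z => ε ^ (n + 1) * Bterm Θ b n₃ γ n δ z) z := by
    funext z; rfl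
  rw [e, partialQ_const_mul, partialP_const_mul, partialQ_add hA hB', partialP_add hA hB',
    show (fun z => ε ^ (n + 1) * Bterm Θ b n₃ γ n δ z) = fun z => ε ^ (n + 1) * (Bterm Θ b n₃ γ n δ) z from rfl,
    partialQ_const_mul, partialP_const_mul]
  exact ⟨rfl, rfl⟩

end Regularity

/-! ### The window solution -/

/-- Monotonicity of `ofReal (C ε^a)` in `C`. [folklore] -/
theorem ofReal_const_mul_mono {C C' x : ℝ} (h : C ≤ C') (hx : 0 ≤ x) : ENNReal.ofReal (C * x) ≤ ENNReal.ofReal (C' * x) :=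
  ENNReal.ofReal_le_ofReal (mul_le_mul_of_nonneg_right h hx)

/-- **Theorem 1 on a window, from resonance cut-offs.** For cut-offs `Θ` of a window of `m` sites,
a bond `(a, a+1)` with ROOM (`n₂` sites of `B(a,n₃)` pairwise `> 2R_S` apart), `r` a scheme radius
for `n₁ = 2n₀+1` stages and `n₂ ≥ 8n₀ + 12`: there is `C` such that for every `0 < ε < 1`, with
`δ = ε^{1/4}`, the pair `(U₀, G₀)` is a window solution with locality radius `locRad n₁ n₃ Rθ`:
smooth, angle-periodic, local, `εJ_{a,a+1} = L_H U₀ + ε^{n₀+1} G₀`, and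
`⟨U₀²⟩_T ≤ Cε^{1/4}`, `⟨|∇U₀|²⟩_T ≤ Cε^{-1/4}`, `⟨G₀²⟩_T ≤ C`, `⟨|∇G₀|²⟩_T ≤ C` (coordinatewise majorants).
[cite: DeRoeckHuveneers2015, §2.3 Thm 1 and §5.2–5.6] -/
theorem windowSolution_of_cutoffs {r L n₂ : ℕ} (Θ : ResonanceCutoffs m r L n₂) (b : Fin m) (n₃ : ℕ) (γ : ℝ) {T : ℝ} (hT : 0 < T)
    (n₀ : ℕ) (hr : IsSchemeRadius (2 * n₀ + 1) r) (hn₂ : 8 * n₀ + 12 ≤ n₂) (hroom : HasRoom Θ.RS n₂ b n₃) :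
    ∃ C : ℝ, ∀ ε : ℝ, 0 < ε → ε < 1 →
      IsWindowSolution m b γ T ε n₀ (locRad (2 * n₀ + 1) n₃ Θ.Rθ) C
        (U0 Θ b n₃ γ (2 * n₀ + 1) ε (scale ε)) (G0 Θ b n₃ γ n₀ (2 * n₀ + 1) ε (scale ε)) := by
  set n : ℕ := 2 * n₀ + 1 with hn_def
  have hn : 1 ≤ n := by omega
  -- the pointwise bounds
  obtain ⟨KU, MU, hKU, hU⟩ := U0_bound (Θ := Θ) (b := b) (n₃ := n₃) (γ := γ) hn
  obtain ⟨KdU, MdU, hKdU, hdU⟩ := dU0_bound (Θ := Θ) (b := b) (n₃ := n₃) (γ := γ) hn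
  obtain ⟨KA, MA, hKA, hA⟩ := Aterm_bound (Θ := Θ) (γ := γ) hr hroom
  obtain ⟨KB, MB, hKB, hB⟩ := Bterm_bound (Θ := Θ) (b := b) (n₃ := n₃) (γ := γ) (n := n)
  -- the Gaussian constants
  have hv : T.toNNReal ≠ 0 := by simpa using hT
  have h2v : (2 * T.toNNReal : ℝ≥0) ≠ 0 := mul_ne_zero two_ne_zero hv
  obtain ⟨KaU, hKaU0, hKaU⟩ := lintegral_indicator_weight_le m (2 * MU) hv
  obtain ⟨KadU, hKadU0, hKadU⟩ := lintegral_indicator_weight_le m (2 * MdU) hv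
  obtain ⟨KaG, hKaG0, hKaG⟩ := lintegral_indicator_weight_le m (2 * (MA ⊔ MB)) hv
  set R₁ : ℕ := n₃ + Θ.RS with hR₁
  set Rz : ℕ := n₃ + Θ.RS with hRz
  obtain ⟨CZ1, hCZ10, hZ1⟩ := measure_Z1set_le m r b R₁ h2v
  obtain ⟨CZ, hCZ0, hZ⟩ := measure_Zset_le m r n₂ b Rz h2v
  set Lf : ℝ := (L : ℝ) ^ (n₂ + 1) with hLf
  have hLf0 : 0 ≤ Lf := by positivity
  -- the four constants
  set C₁ : ℝ := 2 * KU ^ 2 * KaU * (CZ1 * Lf) + 2 * (KU * n) ^ 2 * KaU with hC₁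
  set C₂ : ℝ := 2 * KdU ^ 2 * KadU * (CZ1 * Lf) + 2 * (KdU * n) ^ 2 * KadU with hC₂
  set C₃ : ℝ := 2 * (KA * (n + 1)) ^ 2 * KaG * (CZ * Lf ^ n₂) + 2 * KB ^ 2 * KaG with hC₃
  set C₄ : ℝ := 2 * (KA * (n + 1)) ^ 2 * KaG * (CZ * Lf ^ n₂) + 2 * KB ^ 2 * KaG with hC₄
  refine ⟨max (max C₁ C₂) (max C₃ C₄), fun ε hε hε1 => ?_⟩
  set δ : ℝ := scale ε with hδdef
  have hδ : 0 < δ := scale_pos hε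
  have hδ1 : δ ≤ 1 := scale_le_one hε hε1.le
  have hε' : ∀ a : ℝ, 0 ≤ ε ^ a := fun a => Real.rpow_nonneg hε.le a
  have hn₂R : (8 * n₀ + 12 : ℝ) ≤ n₂ := by exact_mod_cast hn₂
  have hnR : (n : ℝ) = 2 * n₀ + 1 := by rw [hn_def]; push_cast; ring
  -- measure bounds at width `η = Lf δ`
  have hη : 0 ≤ Lf * δ := mul_nonneg hLf0 hδ.le
  have hZ1' : (Measure.pi fun _ : Fin m => gaussianReal 0 (2 * T.toNNReal)) (Z1set m r b R₁ (Lf * δ)) ≤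
      ENNReal.ofReal (CZ1 * Lf * ε ^ (1 / 4 : ℝ)) := by
    refine (hZ1 _ hη).trans (le_of_eq ?_); rw [hδdef, scale]; ring_nf
  have hZ' : (Measure.pi fun _ : Fin m => gaussianReal 0 (2 * T.toNNReal)) (Zset m r n₂ b Rz (Lf * δ)) ≤
      ENNReal.ofReal (CZ * Lf ^ n₂ * ε ^ ((n₂ : ℝ) / 4)) := by
    refine (hZ _ hη).trans (le_of_eq ?_)
    rw [mul_pow, hδdef, scale, ← Real.rpow_natCast (ε ^ (1 / 4 : ℝ)) n₂, ← Real.rpow_mul hε.le]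
    ring_nf
  -- scale sums
  have hS1 : ∑ j ∈ Finset.Ico 1 (n + 1), ε ^ j / δ ^ (2 * j) ≤ n * ε ^ (1 / 2 : ℝ) := by
    have := sum_scale_le hε hε1.le (Finset.Ico 1 (n + 1)) 0 (1 / 2) fun j hj => by
      have hj1 : (1 : ℝ) ≤ j := by exact_mod_cast (Finset.mem_Ico.1 hj).1
      push_cast; linarith
    simpa using this
  have hS2 : ∑ j ∈ Finset.Ico 1 (n + 1), ε ^ j / δ ^ (2 * j + 1) ≤ n * ε ^ (1 / 4 : ℝ) := by
    have := sum_scale_le hε hε1.le (Finset.Ico 1 (n + 1)) 1 (1 / 4) fun j hj => by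
      have hj1 : (1 : ℝ) ≤ j := by exact_mod_cast (Finset.mem_Ico.1 hj).1
      push_cast; linarith
    simpa using this
  have hS3 : ∑ l ∈ Finset.range (n + 1), ε ^ l / δ ^ (2 * l + 1) ≤ (n + 1) * ε ^ (-(1 / 4) : ℝ) := by
    have := sum_scale_le hε hε1.le (Finset.range (n + 1)) 1 (-(1 / 4)) fun l _ => by
      have hl0 : (0 : ℝ) ≤ l := Nat.cast_nonneg l
      push_cast; linarith
    simpa using this
  have hS4 : ∑ l ∈ Finset.range (n + 1), ε ^ l / δ ^ (2 * l + 2) ≤ (n + 1) * ε ^ (-(1 / 2) : ℝ) := by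
    have := sum_scale_le hε hε1.le (Finset.range (n + 1)) 2 (-(1 / 2)) fun l _ => by
      have hl0 : (0 : ℝ) ≤ l := Nat.cast_nonneg l
      push_cast; linarith
    simpa using this
  -- the bounds in majorant form
  have hZ1m : MeasurableSet (Z1set m r b R₁ (Lf * δ)) := measurableSet_Z1set m r b R₁ _
  have hZm : MeasurableSet (Zset m r n₂ b Rz (Lf * δ)) := measurableSet_Zset m r n₂ b Rz _
  have hptU : ∀ (_ : Unit) (z : PhaseSpace m), |U0 Θ b n₃ γ n ε δ z| ≤
      ((Z1set m r b R₁ (Lf * δ)).indicator (fun _ => (1 : ℝ)) z.2 * KU * ε ^ (0 : ℝ) + (KU * n) * ε ^ (1 / 2 : ℝ)) * (1 + ‖z.2‖) ^ MU := by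
    intro _ z
    have h := hU δ hδ hδ1 ε hε.le hε1.le (R₁ := R₁) le_rfl z
    rw [Real.rpow_zero, mul_one]
    refine h.trans ?_
    have hW : 0 ≤ (1 + ‖z.2‖) ^ MU := by positivity
    refine mul_le_mul_of_nonneg_right ?_ hW
    linarith [mul_le_mul_of_nonneg_left hS1 hKU]
  obtain ⟨uU, huUm, huU, huUi⟩ := exists_majorant (m := m) (M := MU) (T := T) hKaU0 hKaU hZ1m (fun _ : Unit => U0 Θ b n₃ γ n ε δ)
    hKU (by positivity) hε hε1.le (a₁ := 0) (a₂ := 1 / 2) (eZ := 1 / 4) (tgt := 1 / 4) (CZ := CZ1 * Lf) (by positivity) hptU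
    (by simpa [mul_assoc] using hZ1') (by norm_num) (by norm_num)
  -- `∂U`
  have hptdU : ∀ (i : Fin m × Bool) (z : PhaseSpace m),
      |(if i.2 then partialQ i.1 (U0 Θ b n₃ γ n ε δ) z else partialP i.1 (U0 Θ b n₃ γ n ε δ) z)| ≤
        ((Z1set m r b R₁ (Lf * δ)).indicator (fun _ => (1 : ℝ)) z.2 * KdU * ε ^ (-(1 / 4) : ℝ) + (KdU * n) * ε ^ (1 / 4 : ℝ)) *
          (1 + ‖z.2‖) ^ MdU := by
    intro i z
    obtain ⟨hq, hp⟩ := hdU δ hδ hδ1 ε hε.le hε1.le (R₁ := R₁) le_rfl i.1 z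
    have hχ : 0 ≤ (Z1set m r b R₁ (Lf * δ)).indicator (fun _ => (1 : ℝ)) z.2 := Set.indicator_nonneg (fun _ _ => zero_le_one) _
    have hW : 0 ≤ (1 + ‖z.2‖) ^ MdU := by positivity
    have hinv : (1 : ℝ) / δ = ε ^ (-(1 / 4) : ℝ) := by simpa using one_div_scale_pow hε 1
    have hrhs : KdU * ((Z1set m r b R₁ (Lf * δ)).indicator (fun _ => (1 : ℝ)) z.2 / δ +
        ∑ j ∈ Finset.Ico 1 (n + 1), ε ^ j / δ ^ (2 * j + 1)) * (1 + ‖z.2‖) ^ MdU ≤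
        ((Z1set m r b R₁ (Lf * δ)).indicator (fun _ => (1 : ℝ)) z.2 * KdU * ε ^ (-(1 / 4) : ℝ) + (KdU * n) * ε ^ (1 / 4 : ℝ)) *
          (1 + ‖z.2‖) ^ MdU := by
      refine mul_le_mul_of_nonneg_right ?_ hW
      rw [div_eq_mul_one_div, hinv]
      linarith [mul_le_mul_of_nonneg_left hS2 hKdU]
    split_ifs
    · exact hq.trans hrhs
    · exact hp.trans hrhs
  obtain ⟨udU, hudUm, hudU, hudUi⟩ := exists_majorant (m := m) (M := MdU) (T := T) hKadU0 hKadU hZ1m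
    (fun i : Fin m × Bool => fun z => if i.2 then partialQ i.1 (U0 Θ b n₃ γ n ε δ) z else partialP i.1 (U0 Θ b n₃ γ n ε δ) z)
    hKdU (by positivity) hε hε1.le (a₁ := -(1 / 4)) (a₂ := 1 / 4) (eZ := 1 / 4) (tgt := -(1 / 4)) (CZ := CZ1 * Lf) (by positivity) hptdU
    (by simpa [mul_assoc] using hZ1') (by norm_num) (by norm_num)
  -- `G`
  have hRz1 : n₃ + Θ.RS ≤ Rz := by rw [hRz]
  have hG0abs : ∀ (A B : ℝ), |(ε ^ (n₀ + 1))⁻¹ * (A + ε ^ (n + 1) * B)| ≤ ε ^ (-((n₀ : ℝ) + 1)) * |A| + ε ^ ((n : ℝ) + 1 - ((n₀ : ℝ) + 1)) * |B| := by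
    intro A B
    have e1 : (ε ^ (n₀ + 1))⁻¹ = ε ^ (-((n₀ : ℝ) + 1)) := by
      rw [← Real.rpow_natCast, ← Real.rpow_neg hε.le]; push_cast; ring_nf
    have e2 : (ε ^ (n₀ + 1))⁻¹ * ε ^ (n + 1) = ε ^ ((n : ℝ) + 1 - ((n₀ : ℝ) + 1)) := by
      rw [e1, ← Real.rpow_natCast ε (n + 1), ← Real.rpow_add hε]; push_cast; ring_nf
    calc |(ε ^ (n₀ + 1))⁻¹ * (A + ε ^ (n + 1) * B)| = |(ε ^ (n₀ + 1))⁻¹ * A + ((ε ^ (n₀ + 1))⁻¹ * ε ^ (n + 1)) * B| := by ring_nf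
      _ ≤ |(ε ^ (n₀ + 1))⁻¹ * A| + |((ε ^ (n₀ + 1))⁻¹ * ε ^ (n + 1)) * B| := abs_add_le _ _
      _ = ε ^ (-((n₀ : ℝ) + 1)) * |A| + ε ^ ((n : ℝ) + 1 - ((n₀ : ℝ) + 1)) * |B| := by
          rw [abs_mul, abs_mul, e2, e1, abs_of_nonneg (hε' _), abs_of_nonneg (hε' _)]
  have hptG : ∀ (_ : Unit) (z : PhaseSpace m), |G0 Θ b n₃ γ n₀ n ε δ z| ≤
      ((Zset m r n₂ b Rz (Lf * δ)).indicator (fun _ => (1 : ℝ)) z.2 * (KA * (n + 1)) * ε ^ (-((n₀ : ℝ) + 1) - 1 / 4) +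
        KB * ε ^ (1 / 4 : ℝ)) * (1 + ‖z.2‖) ^ (MA ⊔ MB) := by
    intro _ z
    obtain ⟨hAz, -, -⟩ := hA δ hδ hδ1 ε hε.le hε1.le hRz1 b z
    obtain ⟨hBz, -, -⟩ := hB δ hδ hδ1 b z
    have hχ : 0 ≤ (Zset m r n₂ b Rz (Lf * δ)).indicator (fun _ => (1 : ℝ)) z.2 := Set.indicator_nonneg (fun _ _ => zero_le_one) _
    have hW1 : 1 ≤ 1 + ‖z.2‖ := one_le_weight z.2
    have hWA : (1 + ‖z.2‖) ^ MA ≤ (1 + ‖z.2‖) ^ (MA ⊔ MB) := pow_le_pow_right₀ hW1 le_sup_left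
    have hWB : (1 + ‖z.2‖) ^ MB ≤ (1 + ‖z.2‖) ^ (MA ⊔ MB) := pow_le_pow_right₀ hW1 le_sup_right
    have hW : 0 ≤ (1 + ‖z.2‖) ^ (MA ⊔ MB) := by positivity
    unfold G0
    refine (hG0abs _ _).trans ?_
    -- `A`-part
    have h1 : ε ^ (-((n₀ : ℝ) + 1)) * |Aterm Θ b n₃ γ n ε δ z| ≤
        (Zset m r n₂ b Rz (Lf * δ)).indicator (fun _ => (1 : ℝ)) z.2 * (KA * (n + 1)) * ε ^ (-((n₀ : ℝ) + 1) - 1 / 4) * (1 + ‖z.2‖) ^ (MA ⊔ MB) := by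
      have e : ε ^ (-((n₀ : ℝ) + 1) - 1 / 4) = ε ^ (-((n₀ : ℝ) + 1)) * ε ^ (-(1 / 4) : ℝ) := by
        rw [← Real.rpow_add hε]; ring_nf
      rw [e]
      calc ε ^ (-((n₀ : ℝ) + 1)) * |Aterm Θ b n₃ γ n ε δ z|
          ≤ ε ^ (-((n₀ : ℝ) + 1)) * ((Zset m r n₂ b Rz (Lf * δ)).indicator (fun _ => (1 : ℝ)) z.2 * KA *
              ((n + 1) * ε ^ (-(1 / 4) : ℝ)) * (1 + ‖z.2‖) ^ (MA ⊔ MB)) := by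
            refine mul_le_mul_of_nonneg_left (hAz.trans ?_) (hε' _)
            exact mul_le_mul (mul_le_mul_of_nonneg_left hS3 (by positivity)) hWA (by positivity) (by positivity)
        _ = _ := by ring
    -- `B`-part
    have h2 : ε ^ ((n : ℝ) + 1 - ((n₀ : ℝ) + 1)) * |Bterm Θ b n₃ γ n δ z| ≤ KB * ε ^ (1 / 4 : ℝ) * (1 + ‖z.2‖) ^ (MA ⊔ MB) := by
      have e : ε ^ ((n : ℝ) + 1 - ((n₀ : ℝ) + 1)) * (KB / δ ^ (2 * n + 1)) = KB * ε ^ (1 / 4 : ℝ) := by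
        rw [div_eq_mul_one_div, one_div_scale_pow hε, mul_comm, mul_assoc, ← Real.rpow_add hε]
        congr 1; push_cast; rw [hnR]; ring_nf
      calc ε ^ ((n : ℝ) + 1 - ((n₀ : ℝ) + 1)) * |Bterm Θ b n₃ γ n δ z|
          ≤ ε ^ ((n : ℝ) + 1 - ((n₀ : ℝ) + 1)) * (KB / δ ^ (2 * n + 1) * (1 + ‖z.2‖) ^ (MA ⊔ MB)) :=
            mul_le_mul_of_nonneg_left (hBz.trans (mul_le_mul_of_nonneg_left hWB (by positivity))) (hε' _)
        _ = KB * ε ^ (1 / 4 : ℝ) * (1 + ‖z.2‖) ^ (MA ⊔ MB) := by rw [← mul_assoc, e]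
    linarith [h1, h2]
  have hcond : (0 : ℝ) ≤ 2 * (-((n₀ : ℝ) + 1) - 1 / 4) + (n₂ : ℝ) / 4 := by linarith
  obtain ⟨uG, huGm, huG, huGi⟩ := exists_majorant (m := m) (M := MA ⊔ MB) (T := T) hKaG0 hKaG hZm (fun _ : Unit => G0 Θ b n₃ γ n₀ n ε δ)
    (by positivity) hKB hε hε1.le (a₁ := -((n₀ : ℝ) + 1) - 1 / 4) (a₂ := 1 / 4) (eZ := (n₂ : ℝ) / 4) (tgt := 0) (CZ := CZ * Lf ^ n₂)
    (by positivity) hptG (by simpa [mul_assoc] using hZ') hcond (by norm_num)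
  -- `∂G`
  have hptdG : ∀ (i : Fin m × Bool) (z : PhaseSpace m),
      |(if i.2 then partialQ i.1 (G0 Θ b n₃ γ n₀ n ε δ) z else partialP i.1 (G0 Θ b n₃ γ n₀ n ε δ) z)| ≤
        ((Zset m r n₂ b Rz (Lf * δ)).indicator (fun _ => (1 : ℝ)) z.2 * (KA * (n + 1)) * ε ^ (-((n₀ : ℝ) + 1) - 1 / 2) +
          KB * ε ^ (0 : ℝ)) * (1 + ‖z.2‖) ^ (MA ⊔ MB) := by
    intro i z
    obtain ⟨-, hAq, hAp⟩ := hA δ hδ hδ1 ε hε.le hε1.le hRz1 i.1 z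
    obtain ⟨-, hBq, hBp⟩ := hB δ hδ hδ1 i.1 z
    have hχ : 0 ≤ (Zset m r n₂ b Rz (Lf * δ)).indicator (fun _ => (1 : ℝ)) z.2 := Set.indicator_nonneg (fun _ _ => zero_le_one) _
    have hW1 : 1 ≤ 1 + ‖z.2‖ := one_le_weight z.2
    have hWA : (1 + ‖z.2‖) ^ MA ≤ (1 + ‖z.2‖) ^ (MA ⊔ MB) := pow_le_pow_right₀ hW1 le_sup_left
    have hWB : (1 + ‖z.2‖) ^ MB ≤ (1 + ‖z.2‖) ^ (MA ⊔ MB) := pow_le_pow_right₀ hW1 le_sup_right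
    have hW : 0 ≤ (1 + ‖z.2‖) ^ (MA ⊔ MB) := by positivity
    obtain ⟨eq, ep⟩ := partial_G0 (Θ := Θ) (b := b) (n₃ := n₃) (γ := γ) (n := n) n₀ ε δ i.1 z
    have hgen : ∀ (dA dB : ℝ), |dA| ≤ (Zset m r n₂ b Rz (Lf * δ)).indicator (fun _ => (1 : ℝ)) z.2 * KA *
        (∑ l ∈ Finset.range (n + 1), ε ^ l / δ ^ (2 * l + 2)) * (1 + ‖z.2‖) ^ MA →
        |dB| ≤ KB / δ ^ (2 * n + 2) * (1 + ‖z.2‖) ^ MB →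
        |(ε ^ (n₀ + 1))⁻¹ * (dA + ε ^ (n + 1) * dB)| ≤
          ((Zset m r n₂ b Rz (Lf * δ)).indicator (fun _ => (1 : ℝ)) z.2 * (KA * (n + 1)) * ε ^ (-((n₀ : ℝ) + 1) - 1 / 2) +
            KB * ε ^ (0 : ℝ)) * (1 + ‖z.2‖) ^ (MA ⊔ MB) := by
      intro dA dB hdA hdB
      refine (hG0abs _ _).trans ?_
      have h1 : ε ^ (-((n₀ : ℝ) + 1)) * |dA| ≤
          (Zset m r n₂ b Rz (Lf * δ)).indicator (fun _ => (1 : ℝ)) z.2 * (KA * (n + 1)) * ε ^ (-((n₀ : ℝ) + 1) - 1 / 2) * (1 + ‖z.2‖) ^ (MA ⊔ MB) := by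
        have e : ε ^ (-((n₀ : ℝ) + 1) - 1 / 2) = ε ^ (-((n₀ : ℝ) + 1)) * ε ^ (-(1 / 2) : ℝ) := by
          rw [← Real.rpow_add hε]; ring_nf
        rw [e]
        calc ε ^ (-((n₀ : ℝ) + 1)) * |dA|
            ≤ ε ^ (-((n₀ : ℝ) + 1)) * ((Zset m r n₂ b Rz (Lf * δ)).indicator (fun _ => (1 : ℝ)) z.2 * KA *
                ((n + 1) * ε ^ (-(1 / 2) : ℝ)) * (1 + ‖z.2‖) ^ (MA ⊔ MB)) := by
              refine mul_le_mul_of_nonneg_left (hdA.trans ?_) (hε' _)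
              exact mul_le_mul (mul_le_mul_of_nonneg_left hS4 (by positivity)) hWA (by positivity) (by positivity)
          _ = _ := by ring
      have h2 : ε ^ ((n : ℝ) + 1 - ((n₀ : ℝ) + 1)) * |dB| ≤ KB * ε ^ (0 : ℝ) * (1 + ‖z.2‖) ^ (MA ⊔ MB) := by
        have e : ε ^ ((n : ℝ) + 1 - ((n₀ : ℝ) + 1)) * (KB / δ ^ (2 * n + 2)) = KB * ε ^ (0 : ℝ) := by
          rw [div_eq_mul_one_div, one_div_scale_pow hε, mul_comm, mul_assoc, ← Real.rpow_add hε]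
          congr 1; push_cast; rw [hnR]; ring_nf
        calc ε ^ ((n : ℝ) + 1 - ((n₀ : ℝ) + 1)) * |dB|
            ≤ ε ^ ((n : ℝ) + 1 - ((n₀ : ℝ) + 1)) * (KB / δ ^ (2 * n + 2) * (1 + ‖z.2‖) ^ (MA ⊔ MB)) :=
              mul_le_mul_of_nonneg_left (hdB.trans (mul_le_mul_of_nonneg_left hWB (by positivity))) (hε' _)
          _ = KB * ε ^ (0 : ℝ) * (1 + ‖z.2‖) ^ (MA ⊔ MB) := by rw [← mul_assoc, e]
      linarith [h1, h2]
    split_ifs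
    · rw [eq]; exact hgen _ _ hAq hBq
    · rw [ep]; exact hgen _ _ hAp hBp
  have hcond' : (0 : ℝ) ≤ 2 * (-((n₀ : ℝ) + 1) - 1 / 2) + (n₂ : ℝ) / 4 := by linarith
  obtain ⟨udG, hudGm, hudG, hudGi⟩ := exists_majorant (m := m) (M := MA ⊔ MB) (T := T) hKaG0 hKaG hZm
    (fun i : Fin m × Bool => fun z => if i.2 then partialQ i.1 (G0 Θ b n₃ γ n₀ n ε δ) z else partialP i.1 (G0 Θ b n₃ γ n₀ n ε δ) z)
    (by positivity) hKB hε hε1.le (a₁ := -((n₀ : ℝ) + 1) - 1 / 2) (a₂ := 0) (eZ := (n₂ : ℝ) / 4) (tgt := 0) (CZ := CZ * Lf ^ n₂)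
    (by positivity) hptdG (by simpa [mul_assoc] using hZ') hcond' (by norm_num)
  -- assemble the structure
  have hC₁ : C₁ ≤ max (max C₁ C₂) (max C₃ C₄) := (le_max_left _ _).trans (le_max_left _ _)
  have hC₂ : C₂ ≤ max (max C₁ C₂) (max C₃ C₄) := (le_max_right _ _).trans (le_max_left _ _)
  have hC₃ : C₃ ≤ max (max C₁ C₂) (max C₃ C₄) := (le_max_left _ _).trans (le_max_right _ _)
  have hC₄ : C₄ ≤ max (max C₁ C₂) (max C₃ C₄) := (le_max_right _ _).trans (le_max_right _ _)
  refine ⟨contDiff_U0 ε δ, contDiff_G0 n₀ ε δ, isAnglePeriodic_U0 hδ hδ1 ε, isAnglePeriodic_G0 hδ hδ1 n₀ ε,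
    dependsOnlyNear_U0 hn hδ hδ1 ε, dependsOnlyNear_G0 hn n₀ hδ hδ1 ε,
    fun z => current_identity hn n₀ hε.ne' γ δ z, ⟨uU, huUm, fun z => huU () z, huUi.trans ?_⟩,
    ⟨udU, hudUm, fun z x => ⟨by simpa using hudU (x, true) z, by simpa using hudU (x, false) z⟩, hudUi.trans ?_⟩,
    ⟨uG, huGm, fun z => huG () z, huGi.trans ?_⟩,
    ⟨udG, hudGm, fun z x => ⟨by simpa using hudG (x, true) z, by simpa using hudG (x, false) z⟩, hudGi.trans ?_⟩⟩
  · exact ofReal_const_mul_mono hC₁ (hε' _)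
  · exact ofReal_const_mul_mono hC₂ (hε' _)
  · rw [Real.rpow_zero, mul_one]; exact ENNReal.ofReal_le_ofReal hC₃
  · rw [Real.rpow_zero, mul_one]; exact ENNReal.ofReal_le_ofReal hC₄

end Literature.Barriers.AtomisticToContinuum.HeatConduction.RotorChain

end
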